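import Summits.CriticalPhenomena.PercolationContinuityZ3.Theorems.FK.PressureQDifferentiability
import Summits.CriticalPhenomena.PercolationContinuityZ3.Theorems.FK.LatticeEdgeCounting
import HarnessLib

/-!
# FK-continuity cell, FO-10a: the boundary correction of the box cluster count —
# `Σ_{x∈Λ} |C_x|⁻¹ ≤ k(ω,Λ) ≤ Σ_{x∈Λ} |C_x|⁻¹ + |∂Λ|` and Grimmett's (4.83) IN MEAN: `|Λ_N|⁻¹ φ^b_{p,q}(k(ω,Λ_N)) → φ^b_{p,q}(|C_0|⁻¹)`

Registered R109 (cell INBOX l.7500, 2026-08-25); registry row FO-10a-g341; label CCL-G (coordinator fk-4 g227).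
Cell `fk-continuity` (bschramm), row FO-10a (pressure layer); support file for the FK-continuity transplant
(`--supports stmt-CriticalPhenomena-4575`); builds on p205010 (kernel theorem, internal audit signed; external expert
review pending). Pure proofs; no definitions, no named facts, no sorries; `d ≥ 1` for the limit.
UNCONDITIONAL infinite-volume structure; it decides nothing about FH / TP_FK / the value of `p_c(q)`.

Grimmett's proof of Lemma (4.79) (display after (4.82), p. 94): for a configuration `ω` of `ℤ^d` and a finite `Λ`, the
number `k(ω,Λ)` of open clusters of `(Λ, ω ∩ E_Λ)` is `Σ_{x∈Λ} |C_x ∩ Λ|⁻¹ ≥ Σ_{x∈Λ} |C_x|⁻¹`, where here `C_x ∩ Λ` means the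
cluster of `x` in `ω ∩ E_Λ`, and `k(ω,Λ) − Σ_{x∈Λ} |C_x|⁻¹ ≤ Σ_{x ↔ ∂Λ} |C_x ∩ Λ|⁻¹ ≤ |∂Λ|`; with the ergodic theorem this
gives (4.83). This file proves the two deterministic inequalities and the convergence IN MEAN under the (translation
invariant) infinite-volume measures `φ^b_{p,q}`, which needs no ergodic theorem:

* `sum_inv_ncard_le_sum_inv_ncard_inter` — `Σ_{x∈Λ} |C_x(ω)|⁻¹ ≤ Σ_{x∈Λ} |C_x(ω ∩ E_Λ)|⁻¹`;
* `sum_ite_not_disjoint_inv_ncard_le_card_innerBoundary` — `Σ_{x∈Λ : C_x(ω ∩ E_Λ) ∩ ∂Λ ≠ ∅} |C_x(ω ∩ E_Λ)|⁻¹ ≤ |∂Λ|`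
  (double counting: each cluster meeting `∂Λ` contributes `1 ≤ |C ∩ ∂Λ|`);
* **`sum_inv_ncard_inter_sub_sum_inv_ncard_le_card_innerBoundary`** — `Σ_{x∈Λ} |C_x(ω ∩ E_Λ)|⁻¹ − Σ_{x∈Λ} |C_x(ω)|⁻¹ ≤ |∂Λ|`
  for lattice configurations (a cluster of `ω ∩ E_Λ` avoiding `∂Λ` is the whole cluster, `BoxClusterCountWired`);
* `sum_inv_ncard_openCluster_liftEdges` — for a configuration `η` of the region graph, `Σ_{x∈Λ} |C_x(lift η)|⁻¹ = k(η)`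
  (`ClusterCountInverse`), identifying the sums above with cluster counts;
* `card_innerBoundary_box_le` — `|∂Λ_N| ≤ |Λ_N| − |Λ_{N−1}|`, so `|∂Λ_N|/|Λ_N| → 0`;
* **`tendsto_integral_sum_inv_ncard_inter_div_card_box`** — Grimmett's (4.83) in mean:
  `|Λ_N|⁻¹ ∫ Σ_{x∈Λ_N} |C_x(ω ∩ E_{Λ_N})|⁻¹ dφ^b_{p,q} → κ^b(p,q) = ∫ |C_0|⁻¹ dφ^b_{p,q}` (`b ∈ {0,1}`, `0 ≤ p ≤ 1`, `q ≥ 1`,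
  `d ≥ 1`); without the restriction to `E_{Λ_N}` the mean is EXACTLY `|Λ_N| κ^b` for every `N` by translation invariance
  (`integral_sum_inv_ncard_eq_card_mul`), and `integral_sum_inv_ncard_inter_mem_Icc` is the two-sided finite-`N` bound.

## References

* G. Grimmett, *The Random-Cluster Model*, Springer 2006 (`book:grimmett2006-random-cluster-model`): §4.5, proof of
  Lemma (4.79), displays between (4.82) and (4.83), and (4.83) [PDF p. 94]. [Grimmett2006]
* G. Grimmett, *Percolation*, 2nd ed., Springer 1999: §4.1, Thm. (4.2) (clusters per vertex). [GrimmettPercolation1999]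
-/

noncomputable section

open scoped Classical
open Finset Filter Topology MeasureTheory

namespace Summit.CriticalPhenomena.PercolationContinuityZ3.Theorems.FK

open Literature.Probability.Percolation Literature.Probability.LatticeModels

variable {d : ℕ}

/-! ### The two deterministic inequalities -/

section Deterministic

/-- **`Σ_{x∈Λ} |C_x(ω)|⁻¹ ≤ Σ_{x∈Λ} |C_x(ω ∩ E_Λ)|⁻¹`**: restricting the configuration shrinks the clusters.
[cite: Grimmett2006, proof of Lemma (4.79), display after (4.82)] -/
theorem sum_inv_ncard_le_sum_inv_ncard_inter (ω : BondConfig (Site d)) (Λ : Finset (Site d)) :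
    ∑ x ∈ Λ, (((openCluster ω x).ncard : ℝ))⁻¹ ≤
      ∑ x ∈ Λ, (((openCluster (ω ∩ ↑(edgesIn (zdGraph d) Λ)) x).ncard : ℝ))⁻¹ :=
  Finset.sum_le_sum fun x _ => antitone_inv_ncard_openCluster x (Set.inter_subset_left : ω ∩ _ ⊆ ω)

/-- **Double counting: `Σ_{x∈Λ : C_x(ω ∩ E_Λ) ∩ ∂Λ ≠ ∅} |C_x(ω ∩ E_Λ)|⁻¹ ≤ |∂Λ|`** — the number of clusters of `(Λ, ω ∩ E_Λ)`
meeting the inner vertex boundary `∂Λ` is at most `|∂Λ|`. [cite: Grimmett2006, proof of Lemma (4.79), display after (4.82)] -/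
theorem sum_ite_not_disjoint_inv_ncard_le_card_innerBoundary (ω : BondConfig (Site d)) (Λ : Finset (Site d)) :
    ∑ x ∈ Λ, (if Disjoint (openCluster (ω ∩ ↑(edgesIn (zdGraph d) Λ)) x) ↑(innerBoundary (zdGraph d) Λ) then (0 : ℝ)
      else (((openCluster (ω ∩ ↑(edgesIn (zdGraph d) Λ)) x).ncard : ℝ))⁻¹) ≤ #(innerBoundary (zdGraph d) Λ) := by
  set η : BondConfig (Site d) := ω ∩ ↑(edgesIn (zdGraph d) Λ) with hη
  set D : Finset (Site d) := innerBoundary (zdGraph d) Λ with hD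
  have hDΛ : D ⊆ Λ := fun y hy => (mem_innerBoundary_iff.1 hy).1
  -- clusters of `η` through points of `Λ` stay in `Λ`; membership is symmetric and clusters of members coincide
  have hsub : ∀ x ∈ Λ, openCluster η x ⊆ ↑Λ := fun x hx => openCluster_inter_edgesIn_subset ω hx
  have hcomm : ∀ {x y : Site d}, y ∈ openCluster η x → x ∈ openCluster η y :=
    fun h => SimpleGraph.Reachable.symm h
  have heq : ∀ {x y : Site d}, y ∈ openCluster η x → openCluster η y = openCluster η x := by
    intro x y h
    ext z
    exact ⟨fun hz => SimpleGraph.Reachable.trans h hz, fun hz => SimpleGraph.Reachable.trans (SimpleGraph.Reachable.symm h) hz⟩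
  have hfin : ∀ x ∈ Λ, (openCluster η x).Finite := fun x hx => (Λ.finite_toSet).subset (hsub x hx)
  have hcard : ∀ x ∈ Λ, ((openCluster η x).ncard : ℝ) = #(Λ.filter fun z => z ∈ openCluster η x) := by
    intro x hx
    have hcoe : (↑(Λ.filter fun z => z ∈ openCluster η x) : Set (Site d)) = openCluster η x := by
      rw [Finset.coe_filter]
      ext z
      exact ⟨fun h => h.2, fun h => ⟨hsub x hx h, h⟩⟩
    have h2 : (openCluster η x).ncard = #(Λ.filter fun z => z ∈ openCluster η x) := by
      rw [← Set.ncard_coe_finset (Λ.filter fun z => z ∈ openCluster η x), hcoe]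
    exact_mod_cast h2
  have hpos : ∀ x ∈ Λ, (0 : ℝ) < (openCluster η x).ncard := fun x hx => by
    have h : 0 < (openCluster η x).ncard := (Set.ncard_pos (hfin x hx)).2 ⟨x, mem_openCluster_self η x⟩
    exact_mod_cast h
  -- step A: termwise `≤ |C_x ∩ ∂Λ| / |C_x|`
  have hA : ∀ x ∈ Λ, (if Disjoint (openCluster η x) ↑D then (0 : ℝ) else (((openCluster η x).ncard : ℝ))⁻¹) ≤
      (#(D.filter fun y => y ∈ openCluster η x) : ℝ) / (openCluster η x).ncard := by
    intro x hx
    split_ifs with hdisj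
    · positivity
    · obtain ⟨y, hyC, hyD⟩ := Set.not_disjoint_iff.1 hdisj
      have h1 : (1 : ℝ) ≤ #(D.filter fun y => y ∈ openCluster η x) := by
        exact_mod_cast Finset.card_pos.2 ⟨y, Finset.mem_filter.2 ⟨hyD, hyC⟩⟩
      rw [inv_eq_one_div]
      exact div_le_div_of_nonneg_right h1 (hpos x hx).le
  refine (Finset.sum_le_sum hA).trans ?_
  -- step B: exchange the sums
  have hB : ∑ x ∈ Λ, (#(D.filter fun y => y ∈ openCluster η x) : ℝ) / (openCluster η x).ncard =
      ∑ y ∈ D, ∑ x ∈ Λ, (if y ∈ openCluster η x then (((openCluster η x).ncard : ℝ))⁻¹ else 0) := by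
    rw [Finset.sum_comm]
    refine Finset.sum_congr rfl fun x _ => ?_
    rw [Finset.card_filter, Nat.cast_sum, Finset.sum_div]
    refine Finset.sum_congr rfl fun y _ => ?_
    split_ifs <;> simp
  rw [hB]
  -- step C: for `y ∈ ∂Λ`, `Σ_{x ∈ Λ} [y ∈ C_x]/|C_x| = |C_y|/|C_y| = 1`
  have hC : ∀ y ∈ D, ∑ x ∈ Λ, (if y ∈ openCluster η x then (((openCluster η x).ncard : ℝ))⁻¹ else 0) = 1 := by
    intro y hy
    have hyΛ : y ∈ Λ := hDΛ hy
    have h1 : ∀ x ∈ Λ, (if y ∈ openCluster η x then (((openCluster η x).ncard : ℝ))⁻¹ else 0) =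
        (if x ∈ openCluster η y then (((openCluster η y).ncard : ℝ))⁻¹ else 0) := by
      intro x _
      by_cases h : y ∈ openCluster η x
      · rw [if_pos h, if_pos (hcomm h), heq h]
      · have h' : x ∉ openCluster η y := fun h' => h (hcomm h')
        rw [if_neg h, if_neg h']
    rw [Finset.sum_congr rfl h1, ← Finset.sum_filter, Finset.sum_const, nsmul_eq_mul, ← hcard y hyΛ,
      mul_inv_cancel₀ (hpos y hyΛ).ne']
  rw [Finset.sum_congr rfl hC, Finset.sum_const, nsmul_eq_mul, mul_one]

/-- **`Σ_{x∈Λ} |C_x(ω ∩ E_Λ)|⁻¹ − Σ_{x∈Λ} |C_x(ω)|⁻¹ ≤ |∂Λ|`** for lattice configurations `ω ⊆ E(ℤ^d)`: the two clusters of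
`x` differ only if the restricted one meets `∂Λ`. [cite: Grimmett2006, proof of Lemma (4.79), display after (4.82)] -/
theorem sum_inv_ncard_inter_sub_sum_inv_ncard_le_card_innerBoundary {ω : BondConfig (Site d)}
    (hω : ω ⊆ (zdGraph d).edgeSet) (Λ : Finset (Site d)) :
    ∑ x ∈ Λ, (((openCluster (ω ∩ ↑(edgesIn (zdGraph d) Λ)) x).ncard : ℝ))⁻¹ -
        ∑ x ∈ Λ, (((openCluster ω x).ncard : ℝ))⁻¹ ≤ #(innerBoundary (zdGraph d) Λ) := by
  rw [← Finset.sum_sub_distrib]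
  refine le_trans (Finset.sum_le_sum fun x hx => ?_) (sum_ite_not_disjoint_inv_ncard_le_card_innerBoundary ω Λ)
  split_ifs with hdisj
  · rw [openCluster_eq_of_disjoint_innerBoundary hω hx hdisj, sub_self]
  · linarith [inv_nonneg.2 (Nat.cast_nonneg (openCluster ω x).ncard : (0 : ℝ) ≤ _)]

/-- For a configuration `η` of the region graph `(Λ, E_Λ)`: `Σ_{x∈Λ} |C_x(lift η)|⁻¹ = k(η)`, the number of open clusters
of `η` (so the sums above ARE cluster counts). [cite: Grimmett2006, proof of Lemma (4.79), display after (4.82)] -/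
theorem sum_inv_ncard_openCluster_liftEdges (Λ : Finset (Site d)) (η : BondConfig ↥Λ) :
    ∑ x ∈ Λ, (((openCluster (liftEdges Λ η) x).ncard : ℝ))⁻¹ = (clusterCount η ∅ : ℝ) := by
  rw [clusterCount_empty_eq_sum_inv_ncard_openCluster, ← Finset.sum_coe_sort Λ]
  refine Finset.sum_congr rfl fun x _ => ?_
  rw [ncard_openCluster_liftEdges]

end Deterministic

/-! ### Grimmett's (4.83) in mean under `φ^b_{p,q}` -/

section Mean

variable {p q : ℝ}

/-- `|∂Λ_N| ≤ |Λ_N| − |Λ_{N−1}|` for `N ≥ 1`: a boundary site has a coordinate of modulus `N`. [folklore] -/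
theorem card_innerBoundary_box_le {N : ℕ} (hN : 1 ≤ N) :
    #(innerBoundary (zdGraph d) (box d N)) ≤ #(box d N) - #(box d (N - 1)) := by
  rw [← Finset.card_sdiff_of_subset (box_mono d (Nat.sub_le N 1))]
  refine Finset.card_le_card fun y hy => ?_
  rw [mem_innerBoundary_iff] at hy
  obtain ⟨hyN, z, hz, hyz⟩ := hy
  rw [Finset.mem_sdiff]
  refine ⟨hyN, fun hy1 => hz ?_⟩
  have h := Literature.Probability.LatticeModels.mem_box_succ_of_adj hyz hy1
  rwa [Nat.sub_add_cancel hN] at h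

/-- `|∂Λ_N| / |Λ_N| → 0`. [folklore] -/
theorem tendsto_card_innerBoundary_box_div_card_box :
    Tendsto (fun N : ℕ => (#(innerBoundary (zdGraph d) (box d N)) : ℝ) / #(box d N)) atTop (𝓝 0) := by
  have h1 : Tendsto (fun N : ℕ => 1 - (#(box d (N - 1)) : ℝ) / #(box d N)) atTop (𝓝 0) := by
    have h := (tendsto_const_nhds (x := (1 : ℝ))).sub (tendsto_card_box_sub_div_card_box (d := d) 1)
    rwa [sub_self] at h
  refine squeeze_zero' (Eventually.of_forall fun N => by positivity) ?_ h1
  filter_upwards [eventually_ge_atTop 1] with N hN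
  have hpos : (0 : ℝ) < #(box d N) := by exact_mod_cast Finset.card_pos.2 (box_nonempty d N)
  rw [div_le_iff₀ hpos, sub_mul, one_mul, div_mul_cancel₀ _ hpos.ne']
  have h := card_innerBoundary_box_le (d := d) hN
  have hle : #(box d (N - 1)) ≤ #(box d N) := Finset.card_le_card (box_mono d (Nat.sub_le N 1))
  have h' : (#(innerBoundary (zdGraph d) (box d N)) : ℝ) ≤ (#(box d N) : ℝ) - #(box d (N - 1)) := by
    rw [← Nat.cast_sub hle]; exact_mod_cast h
  exact h'

/-- `ω ↦ |C_x(ω ∩ F)|⁻¹` is integrable under every finite measure (bounded by `1`, measurable). [folklore] -/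
theorem integrable_inv_ncard_openCluster_inter (x : Site d) (F : Set (Sym2 (Site d)))
    (P : Measure (BondConfig (Site d))) [IsFiniteMeasure P] :
    Integrable (fun ω => (((openCluster (ω ∩ F) x).ncard : ℝ))⁻¹) P :=
  Integrable.of_bound ((measurable_inv_ncard_openCluster' x).comp (measurable_inter_const F)).aestronglyMeasurable 1
    (Eventually.of_forall fun ω => by
      rw [Real.norm_eq_abs, abs_of_nonneg (inv_nonneg.2 (Nat.cast_nonneg _))]
      exact Nat.cast_inv_le_one _)

/-- Under `φ^b_{p,q}`: `Σ_{x∈Λ_N} ∫ |C_x|⁻¹ = |Λ_N| κ^b(p,q)` (translation invariance). [cite: Grimmett2006, Thm. (4.19)(b)] -/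
theorem integral_sum_inv_ncard_eq_card_mul (b : Bool) (hp : p ∈ Set.Icc (0 : ℝ) 1) (hq : 1 ≤ q) (N : ℕ) :
    ∫ ω, ∑ x ∈ box d N, (((openCluster ω x).ncard : ℝ))⁻¹ ∂(rcLimit d b p q) =
      #(box d N) * ∫ ω, ((openCluster ω (0 : Site d)).ncard : ℝ)⁻¹ ∂(rcLimit d b p q) := by
  haveI := isProbabilityMeasure_rcLimit (d := d) b p q
  rw [integral_finsetSum _ fun x _ => integrable_inv_ncard_openCluster' x _]
  simp_rw [integral_inv_ncard_openCluster_rcLimit_eq b hp hq]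
  rw [Finset.sum_const, nsmul_eq_mul]

/-- **The box cluster count under `φ^b_{p,q}`, in mean, is within `|∂Λ_N|` of `|Λ_N| κ^b`:**
`|Λ_N| κ^b ≤ ∫ Σ_{x∈Λ_N} |C_x(ω ∩ E_{Λ_N})|⁻¹ dφ^b_{p,q} ≤ |Λ_N| κ^b + |∂Λ_N|`.
[cite: Grimmett2006, proof of Lemma (4.79), displays after (4.82)] -/
theorem integral_sum_inv_ncard_inter_mem_Icc (b : Bool) (hp : p ∈ Set.Icc (0 : ℝ) 1) (hq : 1 ≤ q) (N : ℕ) :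
    ∫ ω, ∑ x ∈ box d N, (((openCluster (ω ∩ ↑(edgesIn (zdGraph d) (box d N))) x).ncard : ℝ))⁻¹ ∂(rcLimit d b p q) ∈
      Set.Icc (#(box d N) * ∫ ω, ((openCluster ω (0 : Site d)).ncard : ℝ)⁻¹ ∂(rcLimit d b p q))
        (#(box d N) * ∫ ω, ((openCluster ω (0 : Site d)).ncard : ℝ)⁻¹ ∂(rcLimit d b p q) +
          #(innerBoundary (zdGraph d) (box d N))) := by
  have hq0 : 0 < q := one_pos.trans_le hq
  haveI := isProbabilityMeasure_rcLimit (d := d) b p q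
  have hlat := (isBoxLimit_rcLimit b hp hq).ae_subset_edgeSet hp hq0 (d := d)
  have hintF : Integrable (fun ω => ∑ x ∈ box d N,
      (((openCluster (ω ∩ ↑(edgesIn (zdGraph d) (box d N))) x).ncard : ℝ))⁻¹) (rcLimit d b p q) :=
    integrable_finsetSum _ fun x _ => integrable_inv_ncard_openCluster_inter x _ _
  have hintG : Integrable (fun ω => ∑ x ∈ box d N, (((openCluster ω x).ncard : ℝ))⁻¹) (rcLimit d b p q) :=
    integrable_finsetSum _ fun x _ => integrable_inv_ncard_openCluster' x _
  rw [← integral_sum_inv_ncard_eq_card_mul b hp hq N]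
  constructor
  · exact integral_mono hintG hintF fun ω => sum_inv_ncard_le_sum_inv_ncard_inter ω (box d N)
  · have hae : ∀ᵐ ω ∂(rcLimit d b p q), (∑ x ∈ box d N,
        (((openCluster (ω ∩ ↑(edgesIn (zdGraph d) (box d N))) x).ncard : ℝ))⁻¹) ≤
        (∑ x ∈ box d N, (((openCluster ω x).ncard : ℝ))⁻¹) + (#(innerBoundary (zdGraph d) (box d N)) : ℝ) := by
      filter_upwards [hlat] with ω hω
      have h1 := sum_inv_ncard_inter_sub_sum_inv_ncard_le_card_innerBoundary hω (box d N)
      linarith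
    have hint2 : Integrable (fun ω => (∑ x ∈ box d N, (((openCluster ω x).ncard : ℝ))⁻¹) +
        (#(innerBoundary (zdGraph d) (box d N)) : ℝ)) (rcLimit d b p q) := hintG.add (integrable_const _)
    have h := integral_mono_ae hintF hint2 hae
    rwa [integral_add hintG (integrable_const _), integral_const, smul_eq_mul, probReal_univ,
      one_mul] at h

/-- **Grimmett 2006, (4.83) in mean: `|Λ_N|⁻¹ ∫ k(ω,Λ_N) dφ^b_{p,q} → κ^b(p,q) = ∫ |C_0|⁻¹ dφ^b_{p,q}`**, where
`k(ω,Λ_N) = Σ_{x∈Λ_N} |C_x(ω ∩ E_{Λ_N})|⁻¹` is the number of open clusters of `ω` inside the box (`b ∈ {0,1}`, `0 ≤ p ≤ 1`,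
`q ≥ 1`, `d ≥ 1`; no ergodic theorem: translation invariance and `|∂Λ_N|/|Λ_N| → 0`).
[cite: Grimmett2006, (4.83) and the displays before it] -/
theorem tendsto_integral_sum_inv_ncard_inter_div_card_box (hd : 0 < d) (b : Bool) (hp : p ∈ Set.Icc (0 : ℝ) 1)
    (hq : 1 ≤ q) :
    Tendsto (fun N : ℕ => (∫ ω, ∑ x ∈ box d N,
        (((openCluster (ω ∩ ↑(edgesIn (zdGraph d) (box d N))) x).ncard : ℝ))⁻¹ ∂(rcLimit d b p q)) / #(box d N))
      atTop (𝓝 (∫ ω, ((openCluster ω (0 : Site d)).ncard : ℝ)⁻¹ ∂(rcLimit d b p q))) := by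
  have _ := hd
  set κ := ∫ ω, ((openCluster ω (0 : Site d)).ncard : ℝ)⁻¹ ∂(rcLimit d b p q) with hκ
  have hup : Tendsto (fun N : ℕ => κ + (#(innerBoundary (zdGraph d) (box d N)) : ℝ) / #(box d N)) atTop (𝓝 κ) := by
    have h := (tendsto_const_nhds (x := κ)).add (tendsto_card_innerBoundary_box_div_card_box (d := d))
    rwa [add_zero] at h
  refine tendsto_of_tendsto_of_tendsto_of_le_of_le tendsto_const_nhds hup (fun N => ?_) (fun N => ?_)
  · have hpos : (0 : ℝ) < #(box d N) := by exact_mod_cast Finset.card_pos.2 (box_nonempty d N)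
    rw [le_div_iff₀ hpos, mul_comm]
    exact (integral_sum_inv_ncard_inter_mem_Icc b hp hq N).1
  · have hpos : (0 : ℝ) < #(box d N) := by exact_mod_cast Finset.card_pos.2 (box_nonempty d N)
    rw [div_le_iff₀ hpos, add_mul, div_mul_cancel₀ _ hpos.ne', mul_comm]
    exact (integral_sum_inv_ncard_inter_mem_Icc b hp hq N).2

end Mean

end Summit.CriticalPhenomena.PercolationContinuityZ3.Theorems.FK

end
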